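import Literature.AnabelianGeometry.EtaleTheta.LogDivisorModelTateTowerKummerTwistCompat

/-!
# [EtTh] Def. 3.3 (i)(c)/(ii) v3: the ζ-TWISTED Kummer–Tate group with `r` KUMMER CLASSES PER LEVEL
# `Grp_r := (∏_n (ℤ/M_n)^r ⋊_χ C) × ℤ_γ` and its `LevelSystem` («GRP₃» = `r = 3`: roots of `ϖ̈`, of `Ü`, of `Θ̈`)

S. Mochizuki, *The étale theta function …*, Publ. RIMS **45** (2009) [MochizukiEtTh2009], §1 p.13 («`K_N := K(ζ_N,
q_X^{1/N})`»: the constant field acts on `N`-th roots through the cyclotomic character), Prop. 1.4 p.21–22 (the theta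
function `Θ̈` on `Ÿ` and its roots along the tower), §3 Def. 3.3 (i)(c) p.72 (`Δ^{fil,∞}_i`), (ii) p.73 (`Δ^fil`-closures,
the level of a connected tempered covering) [cite: MochizukiEtTh2009, Def 3.3 (ii) p.73].

CLASS (b) DESIGN MODEL (abc-iut cell, layer L2; abc-iut-L2-lead gen 6 R849/R852: TATE TOWER v3 piece 2b(ii) «GRP₃», the
GROUP SIDE; seat abc-iut-L1-t6 g5).  abc-iut-L2-t3's Tate tower v3 (`LogDivisorModelTateTowerTheta*`, p476816/p477445,
level datum p-2a `TateTowerThetaTwist.model`) records at level `m` the functions `μ × μ₂ × ⟨ϖ̈^{1/m}⟩ × ⟨Ü^{1/m}⟩ ×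
⟨Θ̈^{1/m}⟩`; the design fork 2b was RULED (ii): a THIRD Kummer factor `K_Θ` — the only version in which «`η̈ mod N`» has
content at a tower witness.  This file is the `r`-coordinate generalisation of THIS LINEAGE's `r = 2` group
`TateTowerKummerTwist.Grp = (∏_n (ℤ/M_n)² ⋊_χ ∏_n (ℤ/M_n)ˣ) × ℤ_γ` (`LogDivisorModelTateTowerKummerTwistGroup.lean`,
p471292 — UNTOUCHED; nothing of it is restated: `M`, `one_lt_M`, `Cst`, `res`, `M_dvd` are consumed BY NAME), with
`r : ℕ` a PARAMETER:
* Kummer coordinates `K_r := ∏_n (ℤ/M_n)^r` (`KumAdd r := ∀ n, Fin r → ZMod (M n)`, `M n = (n+2)!`; at `r = 3` the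
  coordinates `0 / 1 / 2` of index `n` are the Kummer classes of the `M n`-th roots of `ϖ̈ / Ü / Θ̈`);
* the constant-field factor `C := ∏_n (ℤ/M_n)ˣ` (= `TateTowerKummerTwist.Cst`) acting on ALL `r` classes of index `n`
  through the level-wise CYCLOTOMIC CHARACTER `χ_n` (`act r`, `toAdd_act_apply`; jointly continuous, `continuous_act`);
* **`Grp r := (K_r ⋊_χ C) × ℤ_γ`** — topological group (semidirect factor topologised along `g ↦ (g.left, g.right)`,
  abc-iut-w5-d249's `Semidirect.isTopologicalGroup_of_continuous_action`; instances on the NEW carrier `KC r` only);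
* Def. 3.3 (i)(c)/(ii): `closure r n = Δ_n := {γ = 1, c = 1, all r Kummer coordinates of index < n trivial}` is NORMAL
  (`conj_ofKum`: `h (k,1,1) h⁻¹ = (χ(h_C)·k, 1, 1)` — the ζ-twist — and `χ` acts coordinatewise), nested
  (`closure_antitone`; strictly when `r ≠ 0`: `le_of_closure_le`), every open neighbourhood of `1` contains some `Δ_n`
  (`exists_closure_subset_of_isOpen`), so every connected tempered `Grp r`-set has a level (`lvl`; conjugate
  stabilisers + normality): **`levels r : LevelSystem (Grp r)`, BOTH laws PROVED**; `conj_delta_coord` — the conjugation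
  action of the constant field on the index-`n` generator of class `j` IS `χ_n` (non-trivial twist).
The COMPATIBLE part `Ẑ(1)^r ⋊ Ẑˣ × ℤ_γ` and its `LevelSystem` are the sequel file `…KummerTwistCompatR.lean`.
CONVENTION KEPT FROM p471292 (so that abc-iut-L2-d2's level device `castN / N n = (n+1)! / rho / up` of
`LogDivisorModelTateTowerKummerTwistTower.lean` ports coordinate-wise): the index-`n` coordinate is taken mod `M n = (n+2)!`
and `closure r n` constrains the indices `< n`; the level-`n` modulus of a tower over `levels r` is therefore
`N n = (n+1)! = M (n−1)` (abc-iut-L2-d2's finding, STATUS 2026-08-27 00:31:53Z) — the action/tower side (pieces 2b-action / 2c,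
tower lineage) is NOT in this file.
HONEST LABEL: a combinatorial design model for the v2/v3 interfaces, NOT the tempered fundamental group of a Tate curve;
nothing here bears on [IUTchIII] Cor. 3.12; no side taken; typed ≠ proved.
-/

noncomputable section

namespace Literature.AnabelianGeometry.EtaleTheta

open CategoryTheory Function Literature.AlgebraicGeometry.Frobenioids
  Literature.AlgebraicGeometry.Frobenioids.QuasiTemperoid Literature.AnabelianGeometry.SemiGraphs

namespace TateTowerKummerTwistR

open TateTowerKummerTwist (M one_lt_M Cst)

variable (r : ℕ)

/-! ## The Kummer module with `r` classes per level and the cyclotomic action -/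

/-- The additive Kummer coordinates: at index `n`, `r` Kummer classes modulo `M n = (n+2)!` (`r = 3`: roots of `ϖ̈`, of
`Ü`, of `Θ̈`). [cite: MochizukiEtTh2009, Def 3.3 (ii) p.73] -/
abbrev KumAdd : Type := ∀ n : ℕ, Fin r → ZMod (M n)

/-- The Kummer factor `K_r = ∏_n (ℤ/M_n)^r`, written multiplicatively. [cite: MochizukiEtTh2009, Def 3.3 (ii) p.73] -/
abbrev Kum : Type := Multiplicative (KumAdd r)

/-- The level-wise cyclotomic action of `c ∈ C` on the Kummer coordinates: multiplication by `χ_n(c) = c_n` on all `r`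
classes of index `n`, as an additive automorphism. [cite: MochizukiEtTh2009, §1 p.13] -/
def actAdd (c : Cst) : KumAdd r ≃+ KumAdd r where
  toFun k n := c n • k n
  invFun k n := (c n)⁻¹ • k n
  left_inv k := funext fun n => inv_smul_smul (c n) (k n)
  right_inv k := funext fun n => smul_inv_smul (c n) (k n)
  map_add' k k' := funext fun n => smul_add (c n) (k n) (k' n)

/-- `actAdd` on a coordinate. [cite: MochizukiEtTh2009, §1 p.13] -/
@[simp] theorem actAdd_apply (c : Cst) (k : KumAdd r) (n : ℕ) : actAdd r c k n = c n • k n := rfl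

/-- **The cyclotomic character as an action `χ : C →* Aut(K_r)`** (`c ↦` multiplication by `c_n` on the `r` classes of
index `n`). [cite: MochizukiEtTh2009, §1 p.13] -/
def act : Cst →* MulAut (Kum r) where
  toFun c := AddEquiv.toMultiplicative (actAdd r c)
  map_one' := MulEquiv.ext fun k =>
    show Multiplicative.ofAdd (fun n => (1 : Cst) n • k.toAdd n) = k from
      (congrArg Multiplicative.ofAdd (funext fun n => one_smul _ (k.toAdd n))).trans (ofAdd_toAdd k)
  map_mul' c c' := MulEquiv.ext fun k =>
    show Multiplicative.ofAdd (fun n => (c * c') n • k.toAdd n) =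
        Multiplicative.ofAdd (fun n => c n • (Multiplicative.ofAdd (fun m => c' m • k.toAdd m)).toAdd n) from
      congrArg Multiplicative.ofAdd (funext fun n => mul_smul (c n) (c' n) (k.toAdd n))

/-- `act` on a coordinate (additively). [cite: MochizukiEtTh2009, §1 p.13] -/
@[simp] theorem toAdd_act_apply (c : Cst) (k : Kum r) (n : ℕ) : (act r c k).toAdd n = c n • k.toAdd n := rfl

/-- `act` on a single class `j` of index `n`: multiplication by `c_n`. [cite: MochizukiEtTh2009, §1 p.13] -/
theorem toAdd_act_apply_apply (c : Cst) (k : Kum r) (n : ℕ) (j : Fin r) :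
    (act r c k).toAdd n j = (c n : ZMod (M n)) * k.toAdd n j := rfl

/-- **The action `(c, k) ↦ χ(c)·k` is jointly continuous** (each output coordinate depends only on one coordinate of
`c` and of `k`, through discrete finite groups). [cite: MochizukiEtTh2009, §1 p.13] -/
theorem continuous_act : Continuous fun q : Cst × Kum r => act r q.1 q.2 := by
  have h : Continuous fun q : Cst × Kum r => fun n => q.1 n • (q.2.toAdd n) := by
    refine continuous_pi fun n => ?_
    have h1 : Continuous fun q : Cst × Kum r => (q.1 n, q.2.toAdd n) :=
      ((continuous_apply n).comp continuous_fst).prodMk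
        ((continuous_apply n).comp (continuous_toAdd.comp continuous_snd))
    exact (continuous_of_discreteTopology (f := fun s : (ZMod (M n))ˣ × (Fin r → ZMod (M n)) =>
      s.1 • s.2)).comp h1
  exact continuous_ofAdd.comp h

/-! ## The group `(K_r ⋊_χ C) × ℤ_γ` -/

/-- The arithmetic Kummer factor `K_r ⋊_χ C`. [cite: MochizukiEtTh2009, §1 p.13] -/
abbrev KC : Type := Kum r ⋊[act r] Cst

/-- The topology of `K_r ⋊_χ C`: induced along `g ↦ (g.left, g.right) ∈ K_r × C` (the pattern of the tree's χ-twisted §1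
models and of the `r = 2` file). [cite: MochizukiEtTh2009, §1 p.12] -/
instance instTopologicalSpaceKC : TopologicalSpace (KC r) :=
  TopologicalSpace.induced (fun g : KC r => (g.left, g.right)) inferInstance

/-- `g ↦ (g.left, g.right)` is inducing (by definition). [cite: MochizukiEtTh2009, §1 p.12] -/
theorem isInducing_leftRight : Topology.IsInducing fun g : KC r => (g.left, g.right) := ⟨rfl⟩

/-- **`K_r ⋊_χ C` is a topological group.** [cite: MochizukiEtTh2009, §1 p.12] -/
instance instIsTopologicalGroupKC : IsTopologicalGroup (KC r) :=
  SettingModel.Semidirect.isTopologicalGroup_of_continuous_action (isInducing_leftRight r) (continuous_act r)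

/-- **The Galois group of the ζ-twisted Kummer–Tate tower with `r` Kummer classes per level**: `(K_r ⋊_χ C) × ℤ_γ` —
Kummer part, constant field acting through the cyclotomic character, translations of the chain (discrete).
[cite: MochizukiEtTh2009, Def 3.3 (ii) p.73] -/
abbrev Grp : Type := KC r × Multiplicative ℤ

/-- The Kummer element with coordinates `k`: `((k, 1), 1)`. [cite: MochizukiEtTh2009, Def 3.3 (ii) p.73] -/
def ofKum (k : Kum r) : Grp r := (SemidirectProduct.inl k, 1)

/-- `ofKum` is continuous. [cite: MochizukiEtTh2009, Def 3.3 (ii) p.73] -/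
theorem continuous_ofKum : Continuous (ofKum r) :=
  (SettingModel.Semidirect.continuous_inl (isInducing_leftRight r)).prodMk continuous_const

/-- Coordinates of a product: `(g h)_n = k^g_n + χ_n(c^g) · k^h_n`. [cite: MochizukiEtTh2009, §1 p.13] -/
theorem toAdd_left_mul (g h : Grp r) (n : ℕ) :
    (g * h).1.left.toAdd n = g.1.left.toAdd n + g.1.right n • h.1.left.toAdd n := rfl

/-- Coordinates of an inverse: `(g⁻¹)_n = χ_n(c^g)⁻¹ · (−k^g_n)`. [cite: MochizukiEtTh2009, §1 p.13] -/
theorem toAdd_left_inv (g : Grp r) (n : ℕ) : (g⁻¹).1.left.toAdd n = (g.1.right n)⁻¹ • (-(g.1.left.toAdd n)) := rfl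

/-! ## The level subgroups `Δ_n` -/

/-- **`Δ_n = Δ^{fil,∞}_n`**: trivial translation, trivial constant-field component, and ALL `r` Kummer coordinates trivial at
the indices `< n` (a subgroup of the geometric Kummer part). [cite: MochizukiEtTh2009, Def 3.3 (i) p.72] -/
def closure (n : ℕ) : Subgroup (Grp r) where
  carrier := {g | g.2 = 1 ∧ g.1.right = 1 ∧ ∀ i < n, g.1.left.toAdd i = 0}
  mul_mem' := by
    rintro a b ⟨ha, ha', ha''⟩ ⟨hb, hb', hb''⟩
    refine ⟨by rw [Prod.snd_mul, ha, hb, mul_one], by rw [Prod.fst_mul, SemidirectProduct.mul_right, ha', hb', mul_one],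
      fun i hi => ?_⟩
    rw [Prod.fst_mul, SemidirectProduct.mul_left, ha', map_one, MulAut.one_apply, toAdd_mul, Pi.add_apply,
      ha'' i hi, hb'' i hi, add_zero]
  one_mem' := ⟨rfl, rfl, fun _ _ => rfl⟩
  inv_mem' := by
    rintro a ⟨ha, ha', ha''⟩
    refine ⟨by rw [Prod.snd_inv, ha, inv_one], by rw [Prod.fst_inv, SemidirectProduct.inv_right, ha', inv_one],
      fun i hi => ?_⟩
    rw [Prod.fst_inv, SemidirectProduct.inv_left, ha', inv_one, map_one, MulAut.one_apply, toAdd_inv, Pi.neg_apply,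
      ha'' i hi, neg_zero]

/-- Membership in `Δ_n`. [cite: MochizukiEtTh2009, Def 3.3 (i) p.72] -/
theorem mem_closure_iff (n : ℕ) (g : Grp r) :
    g ∈ closure r n ↔ g.2 = 1 ∧ g.1.right = 1 ∧ ∀ i < n, g.1.left.toAdd i = 0 := Iff.rfl

/-- An element of `Δ_n` is the Kummer element of its Kummer coordinates. [cite: MochizukiEtTh2009, Def 3.3 (i) p.72] -/
theorem eq_ofKum_of_mem_closure {n : ℕ} {g : Grp r} (hg : g ∈ closure r n) : g = ofKum r g.1.left := by
  obtain ⟨h2, h1, -⟩ := hg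
  refine Prod.ext (SemidirectProduct.ext ?_ ?_) ?_
  · rw [ofKum, SemidirectProduct.left_inl]
  · rw [ofKum, SemidirectProduct.right_inl, h1]
  · rw [ofKum, h2]

/-- Conjugation of a Kummer element: `h · (k,1,1) · h⁻¹ = (χ(h_C)·k, 1, 1)` — the ζ-TWIST, on all `r` classes at once.
[cite: MochizukiEtTh2009, §1 p.13] -/
theorem conj_ofKum (h : Grp r) (k : Kum r) : h * ofKum r k * h⁻¹ = ofKum r (act r h.1.right k) := by
  refine Prod.ext (SemidirectProduct.ext ?_ ?_) ?_
  · change (h.1 * SemidirectProduct.inl k * h.1⁻¹).left = act r h.1.right k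
    rw [SemidirectProduct.mul_left, SemidirectProduct.mul_left, SemidirectProduct.mul_right,
      SemidirectProduct.left_inl, SemidirectProduct.right_inl, mul_one, SemidirectProduct.inv_left,
      show act r h.1.right (act r h.1.right⁻¹ h.1.left⁻¹) = h.1.left⁻¹ by
        rw [← MulAut.mul_apply, ← map_mul, mul_inv_cancel, map_one, MulAut.one_apply],
      mul_inv_cancel_comm]
  · change (h.1 * SemidirectProduct.inl k * h.1⁻¹).right = 1
    rw [SemidirectProduct.mul_right, SemidirectProduct.mul_right, SemidirectProduct.right_inl, mul_one,
      SemidirectProduct.inv_right, mul_inv_cancel]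
  · change h.2 * 1 * h.2⁻¹ = 1
    rw [mul_one, mul_inv_cancel]

/-- The Kummer element `(k,1,1)` lies in `Δ_n` iff the coordinates of `k` at the indices `< n` vanish.
[cite: MochizukiEtTh2009, Def 3.3 (i) p.72] -/
theorem ofKum_mem_closure_iff (n : ℕ) (k : Kum r) : ofKum r k ∈ closure r n ↔ ∀ i < n, k.toAdd i = 0 := by
  rw [mem_closure_iff]
  simp only [ofKum, SemidirectProduct.right_inl, SemidirectProduct.left_inl, true_and]

/-- **`Δ_n` is NORMAL in `Grp r`** (the constant field acts on the Kummer coordinates coordinatewise, the translations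
centralise them). [cite: MochizukiEtTh2009, Def 3.3 (i) p.72] -/
theorem closure_normal (n : ℕ) : (closure r n).Normal := by
  refine ⟨fun g hg h => ?_⟩
  have hk := (ofKum_mem_closure_iff r n g.1.left).1 (eq_ofKum_of_mem_closure r hg ▸ hg)
  rw [eq_ofKum_of_mem_closure r hg, conj_ofKum, ofKum_mem_closure_iff]
  intro i hi
  rw [toAdd_act_apply, hk i hi, smul_zero]

/-- The `Δ_n` are nested: `Δ_m ⊆ Δ_n` for `n ≤ m`. [cite: MochizukiEtTh2009, Def 3.3 (i) p.72] -/
theorem closure_antitone {n m : ℕ} (h : n ≤ m) : closure r m ≤ closure r n :=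
  fun _ hg => ⟨hg.1, hg.2.1, fun i hi => hg.2.2 i (lt_of_lt_of_le hi h)⟩

/-- The Kummer generator of index `i` and class `j` (`r = 3`: `j = 0 / 1 / 2` = root of `ϖ̈ / Ü / Θ̈`): coordinate `i`
equal to the `j`-th basis vector. [cite: MochizukiEtTh2009, Def 3.3 (ii) p.73] -/
def delta (i : ℕ) (j : Fin r) : Grp r :=
  ofKum r (Multiplicative.ofAdd (Pi.single i (Pi.single j (1 : ZMod (M i)))))

/-- `δ_{i,j} ∈ Δ_n` iff `n ≤ i`. [cite: MochizukiEtTh2009, Def 3.3 (i) p.72] -/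
theorem delta_mem_closure_iff (i : ℕ) (j : Fin r) (n : ℕ) : delta r i j ∈ closure r n ↔ n ≤ i := by
  rw [delta, ofKum_mem_closure_iff]
  constructor
  · intro h
    by_contra hlt
    have h1 := congrArg (fun f => f j) (h i (lt_of_not_ge hlt))
    simp only [toAdd_ofAdd, Pi.single_eq_same, Pi.zero_apply] at h1
    haveI : Fact (1 < M i) := ⟨one_lt_M i⟩
    exact one_ne_zero h1
  · intro h i' hi'
    rw [toAdd_ofAdd, Pi.single_eq_of_ne (Nat.ne_of_lt (lt_of_lt_of_le hi' h))]

/-- `Δ_j ⊆ Δ_i` forces `i ≤ j` as soon as `r ≠ 0`: the level subgroups are pairwise distinct and linearly ordered.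
[cite: MochizukiEtTh2009, Def 3.3 (i) p.72] -/
theorem le_of_closure_le [NeZero r] {i j : ℕ} (h : closure r j ≤ closure r i) : i ≤ j :=
  (delta_mem_closure_iff r j 0 i).1 (h ((delta_mem_closure_iff r j 0 j).2 le_rfl))

/-- **Every open neighbourhood of `1` in `Grp r` contains some `Δ_n`** (the Kummer factor carries the product topology of
finite discrete groups: an open set constrains finitely many indices). [cite: MochizukiEtTh2009, Def 3.3 (i) p.72] -/
theorem exists_closure_subset_of_isOpen {U : Set (Grp r)} (hU : IsOpen U) (h1 : (1 : Grp r) ∈ U) :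
    ∃ n, (closure r n : Set (Grp r)) ⊆ U := by
  let ι : KumAdd r → Grp r := fun k => ofKum r (Multiplicative.ofAdd k)
  have hι : Continuous ι := (continuous_ofKum r).comp continuous_ofAdd
  have h0 : (0 : KumAdd r) ∈ ι ⁻¹' U := by
    change ofKum r (Multiplicative.ofAdd 0) ∈ U
    rw [ofAdd_zero, ofKum, map_one]
    exact h1
  obtain ⟨I, w, hw, hIw⟩ := isOpen_pi_iff.1 (hU.preimage hι) 0 h0
  refine ⟨I.sup id + 1, fun g hg => ?_⟩
  have hk := (ofKum_mem_closure_iff r _ g.1.left).1 (eq_ofKum_of_mem_closure r hg ▸ hg)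
  have hmem : g.1.left.toAdd ∈ (I : Set ℕ).pi w := by
    intro a ha
    have hlt : a < I.sup id + 1 := Nat.lt_succ_of_le (Finset.le_sup (f := id) ha)
    rw [hk a hlt]
    exact (hw a ha).2
  have hU' := hIw hmem
  change ofKum r (Multiplicative.ofAdd g.1.left.toAdd) ∈ U at hU'
  rw [ofAdd_toAdd, ← eq_ofKum_of_mem_closure r hg] at hU'
  exact hU'

/-! ## The level of a connected tempered covering (conjugate stabilisers + normality) -/

/-- A point of a tempered `Grp r`-set is fixed by some `Δ_n` (its stabiliser is open). [cite: MochizukiEtTh2009, Def 3.3 (ii) p.73] -/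
theorem exists_closure_fix (T : BTemp (Grp r)) (y : T.obj.V) : ∃ n, ∀ g ∈ closure r n, T.obj.ρ g y = y := by
  obtain ⟨n, hn⟩ := exists_closure_subset_of_isOpen r (T.property.2 y) (BTempConnected.ρ_one_apply T y)
  exact ⟨n, fun g hg => hn hg⟩

/-- For a CONNECTED tempered covering one `Δ_n` fixes every point: the points form one orbit, the stabiliser of
`h · y₀` is the `h`-conjugate of that of `y₀`, and `Δ_n` is normal. [cite: MochizukiEtTh2009, Def 3.3 (ii) p.73] -/
theorem exists_closure_fixes (Y : ConnectedPart (BTemp (Grp r))) :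
    ∃ n, ∀ g ∈ closure r n, ∀ y : Y.obj.obj.V, Y.obj.obj.ρ g y = y := by
  obtain ⟨y₀⟩ := BTempConnected.nonempty_of_isConnectedObj Y.obj Y.property
  obtain ⟨n, hn⟩ := exists_closure_fix r Y.obj y₀
  refine ⟨n, fun g hg y => ?_⟩
  obtain ⟨h, rfl⟩ := BTempConnected.exists_ρ_eq_of_isConnectedObj Y.obj Y.property y₀ y
  have hc : h⁻¹ * g * h⁻¹⁻¹ ∈ closure r n := (closure_normal r n).conj_mem g hg h⁻¹
  rw [inv_inv] at hc
  rw [← BTempConnected.ρ_mul_apply, show g * h = h * (h⁻¹ * g * h) by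
      rw [← mul_assoc, ← mul_assoc, mul_inv_cancel, one_mul],
    BTempConnected.ρ_mul_apply, hn _ hc]

/-- **The level of a connected tempered covering `Y`**: the least `n` such that `Δ_n` fixes `Y`.
[cite: MochizukiEtTh2009, Def 3.3 (ii) p.73] -/
def lvl (Y : ConnectedPart (BTemp (Grp r))) : ℕ :=
  sInf {n | ∀ g ∈ closure r n, ∀ y : Y.obj.obj.V, Y.obj.obj.ρ g y = y}

/-- `Δ_{lvl Y}` fixes `Y`. [cite: MochizukiEtTh2009, Def 3.3 (i) p.72] -/
theorem closure_lvl_fixes (Y : ConnectedPart (BTemp (Grp r))) :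
    ∀ g ∈ closure r (lvl r Y), ∀ y : Y.obj.obj.V, Y.obj.obj.ρ g y = y :=
  Nat.sInf_mem (s := {n | ∀ g ∈ closure r n, ∀ y : Y.obj.obj.V, Y.obj.obj.ρ g y = y}) (exists_closure_fixes r Y)

/-- Minimality of the level. [cite: MochizukiEtTh2009, Def 3.3 (i) p.72] -/
theorem lvl_le {Y : ConnectedPart (BTemp (Grp r))} {n : ℕ}
    (h : ∀ g ∈ closure r n, ∀ y : Y.obj.obj.V, Y.obj.obj.ρ g y = y) : lvl r Y ≤ n :=
  Nat.sInf_le h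

/-- **Levels are monotone along covering maps** `Y' → Y` (surjective, equivariant). [cite: MochizukiEtTh2009, Def 3.3 (i) p.72] -/
theorem lvl_le_of_hom {Y Y' : ConnectedPart (BTemp (Grp r))} (f : Y' ⟶ Y) : lvl r Y ≤ lvl r Y' := by
  obtain ⟨y'₀⟩ := BTempConnected.nonempty_of_isConnectedObj Y'.obj Y'.property
  refine lvl_le r fun g hg y => ?_
  obtain ⟨y', rfl⟩ := BTempConnected.surjective_of_isConnectedObj y'₀ Y.property f.hom y
  rw [← BTempConnected.hom_ρ, closure_lvl_fixes r Y' g hg y']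

/-- **The level structure of the ζ-twisted Kummer–Tate tower with `r` classes per level** (Def. 3.3 (i)(c)/(ii) for
`(K_r ⋊_χ C) × ℤ_γ`): levels `ℕ`, normal `Δ_n`, `lvl`; BOTH laws PROVED. [cite: MochizukiEtTh2009, Def 3.3 (i) p.72] -/
def levels : LevelSystem (Grp r) where
  I := ℕ
  closure := closure r
  closure_normal := closure_normal r
  lvl := lvl r
  closure_lvl_act Y g hg y := closure_lvl_fixes r Y g hg y
  closure_lvl_mono f := closure_antitone r (lvl_le_of_hom r f)

/-- The levels of `levels r` are linearly ordered by their closures when `r ≠ 0` (input of the transition maps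
`x ↦ x^{M_j/M_i}` of a tower to be built over this group). [cite: MochizukiEtTh2009, Def 3.3 (ii) p.73] -/
theorem levels_le_of_closure_le [NeZero r] {i j : ℕ} (h : (levels r).closure j ≤ (levels r).closure i) : i ≤ j :=
  le_of_closure_le r h

/-- The conjugation action of the constant field on the index-`n` Kummer generator of class `j` IS the cyclotomic
character: `(1, c, 1) · δ_{n,j} · (1, c, 1)⁻¹` has index-`n` coordinates `χ_n(c) · e_j` — the twist is NON-TRIVIAL as soon
as `c_n ≠ 1`, on each of the `r` classes. [cite: MochizukiEtTh2009, §1 p.13] -/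
theorem conj_delta_coord (c : Cst) (n : ℕ) (j : Fin r) :
    (((SemidirectProduct.inr c, 1) : Grp r) * delta r n j * ((SemidirectProduct.inr c, 1) : Grp r)⁻¹).1.left.toAdd n =
      Pi.single j (c n : ZMod (M n)) := by
  rw [delta, conj_ofKum, ofKum, SemidirectProduct.left_inl, SemidirectProduct.right_inr, toAdd_act_apply, toAdd_ofAdd,
    Pi.single_eq_same, Units.smul_def, ← Pi.single_smul, smul_eq_mul, mul_one]

/-! ## `r = 3`: the group of TATE TOWER v3 (roots of `ϖ̈`, `Ü`, `Θ̈`) -/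

/-- **«GRP₃»** — the ζ-twisted Kummer–Tate group of abc-iut-L2-t3's Tate tower v3: three Kummer classes per level (the
roots of `ϖ̈`, of `Ü`, of the theta function `Θ̈`). [cite: MochizukiEtTh2009, Def 3.3 (ii) p.73] -/
abbrev Grp₃ : Type := Grp 3

/-- The class of the roots of `ϖ̈` (coordinate `0`). [cite: MochizukiEtTh2009, Def 3.3 (ii) p.73] -/
abbrev clsUnif : Fin 3 := 0

/-- The class of the roots of `Ü` (coordinate `1`). [cite: MochizukiEtTh2009, Def 3.3 (ii) p.73] -/
abbrev clsCoordU : Fin 3 := 1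

/-- The class of the roots of `Θ̈` (coordinate `2`) — the Kummer class through which «`η̈ mod N`» acquires content at a
tower witness (design fork 2b (ii)). [cite: MochizukiEtTh2009, Prop 1.4 p.21] -/
abbrev clsTheta : Fin 3 := 2

/-- The level structure of «GRP₃», both laws proved, levels pairwise distinct. [cite: MochizukiEtTh2009, Def 3.3 (i) p.72] -/
theorem levels_three_le_of_closure_le {i j : ℕ} (h : (levels 3).closure j ≤ (levels 3).closure i) : i ≤ j :=
  levels_le_of_closure_le 3 h

end TateTowerKummerTwistR

end Literature.AnabelianGeometry.EtaleTheta

end
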